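import Summits.CriticalPhenomena.PercolationContinuityZ3.Theorems.PercNearOneGluingNoHeavyLowerTailGZWheatstone

/-!
# `NoHeavyLowerTail` (stmt-CriticalPhenomena-4575) — support file: **THEOREM W⁺** (cell level), the logarithmic covariance
# bound on the Wheatstone bridge whose BRIDGE SLOT carries an arbitrary hub-bearing two-terminal gadget

Support file (`--supports stmt-CriticalPhenomena-4575`; closes nothing; no definitions, no named facts, no sorries),
prover `prim-ineq-prove-2` gen 16, memo `run/shared/lean/prim/prim-ineq-prove-2/THEOREM-WPLUS.md`.
Setting: hub `c`; the Wheatstone skeleton `a–u (α₁), a–v (α₂), u–b (β₁), v–b (β₂)` (bare edges, weights in `(0,1)`) whose bridge slot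
`u–v` carries an ARBITRARY two-terminal gadget `B` (a finite graph on `u, v` and internal vertices, with hub edges to `c` of any
weights).  `B` enters the `(a,b)`-law of the composite only through its 6-cell law; the proof below needs from it only
`θ_B = P(u ~_B v)`, `w_B = P(u ~_B v, B's block unmarked)` and the unconditional MARK-PATTERN law of its two sides,
`τ = P(both sides marked)`, `α = P(only the u-side marked)`, `β = P(only the v-side marked)`, `ν = P(no mark)` ('marked' = joined
to `c` by an open hub edge inside `B`), with the two hypotheses
* `hL` : `ν τ − α β ≤ w_B log(θ_B/w_B)` — the gadget itself satisfies the bound (L-log of `B`; `ντ − αβ = Cov_B`), and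
* `hH` : `α β ≤ ν τ` — Harris' inequality for the two increasing events 'u-side marked', 'v-side marked'.
With `S = α₁β₁ + α₂β₂ − α₁α₂β₁β₂` (`a ~ b` through the fans), `C = α₁β₂(1−β₁)(1−α₂) + α₂β₁(1−α₁)(1−β₂)` (the slot is pivotal),
`A = 1−(1−α₁)(1−α₂)`, `B' = 1−(1−β₁)(1−β₂)`, `U_a = α₁+(1−α₁)α₂β₂β₁`, `U_b = b₁+(1−b₁)b₂α₂α₁`, `V_a, V_b` (u ↔ v),
`S_u = S − α₂β₂(1−α₁)(1−β₁)`, `S_v = S − α₁β₁(1−α₂)(1−β₂)`, the composite `W[B]` has (exact enumeration, memo §1;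
prim-ineq-prove-2 gen 16, verified by computer algebra against the gluing engine)
`θ = P(a ~ b off c) = S + C θ_B`, `w = P(ab|c) = m + C w_B` with `m = S − (τS + αS_u + βS_v)`,
`P(a~c) = τA + αU_a + βV_a`, `P(b~c) = τB' + αU_b + βV_b`, `P(a~c ∧ b~c) = τS + αS_u + βS_v + Cτ`.
**`wplus_bridge_cov_le` (THEOREM W⁺): `P(a~c ∧ b~c) − P(a~c)P(b~c) ≤ w·log(θ/w)`.**
It contains THEOREM W (`GZWheatstone.wheatstone_cov_le`, the case `B` = bare edge + hubs at `u, v`) and covers e.g. `W + x`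
(a hub vertex `x` joined to `u` and `v`), hub-bearing paths / SP gadgets / nested bridges in the bridge slot.
Proof (memo §1–§2): (1) two-class log-sum inequality (`logsum2`) + `hL` reduce the claim to the 4-cycle `C₄` carrying the
CORRELATED mark pair `(τ,α,β,ν)` at `(u,v)` plus the pivotal credit `C·(ντ−αβ)` (`c4mo`); (2) by `hH` the pair is a
Marshall–Olkin common-shock law `M_u = X ∨ Z_u`, `M_v = X ∨ Z_v` (`q₁ = ν/(ν+α)`, `q₂ = ν/(ν+β)`, `q_X = (ν+α)(ν+β)/ν ≤ 1`);
(3) the common-shock component has `w₁ = 0` and independent `A, B`; the idiosyncratic component is `C₄` with independent hubs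
`1−q₁, 1−q₂` at `u, v`, where the bound is `GZWheatstone.c4_cov_le` (THEOREM SP); (4) the mixture penalty is paid by the
Jensen gain `w₀ log(1/q_X) ≥ (1−q_X)w₀` and the pivotal credit through the Harris-type correlation inequality `key_le`
(`ΔA·ΔB ≤ w₀ + C q₁q₂`, an explicit sum of products of nonnegative polynomials).
[this work — memo THEOREM-WPLUS.md; conjecture: GladkovZimin2024 Conj. 6.3, Gladkov2024 Conj. 10.1]
-/

namespace Summit.CriticalPhenomena.PercolationContinuityZ3.Theorems

namespace GZWheatstonePlus

/-- Two-class log-sum inequality: `m₁ log(P₁/m₁) + m₂ log(P₂/m₂) ≤ (m₁+m₂) log((P₁+P₂)/(m₁+m₂))` for positive reals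
(concavity of `m ↦ m log(P/m)`; proof = `log y ≤ y − 1` twice). -/
theorem logsum2 {m₁ m₂ P₁ P₂ : ℝ} (hm₁ : 0 < m₁) (hm₂ : 0 < m₂) (hP₁ : 0 < P₁) (hP₂ : 0 < P₂) :
    m₁ * Real.log (P₁ / m₁) + m₂ * Real.log (P₂ / m₂) ≤
      (m₁ + m₂) * Real.log ((P₁ + P₂) / (m₁ + m₂)) := by
  have hM : 0 < m₁ + m₂ := by linarith
  have hP : 0 < P₁ + P₂ := by linarith
  -- y_i := (P_i/m_i) / ((P₁+P₂)/(m₁+m₂))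
  have hy₁ : 0 < P₁ / m₁ / ((P₁ + P₂) / (m₁ + m₂)) := by positivity
  have hy₂ : 0 < P₂ / m₂ / ((P₁ + P₂) / (m₁ + m₂)) := by positivity
  have h₁ := Real.log_le_sub_one_of_pos hy₁
  have h₂ := Real.log_le_sub_one_of_pos hy₂
  rw [Real.log_div (by positivity) (by positivity)] at h₁ h₂
  have e₁ : m₁ * (P₁ / m₁ / ((P₁ + P₂) / (m₁ + m₂)) - 1) = P₁ * (m₁ + m₂) / (P₁ + P₂) - m₁ := by
    field_simp
  have e₂ : m₂ * (P₂ / m₂ / ((P₁ + P₂) / (m₁ + m₂)) - 1) = P₂ * (m₁ + m₂) / (P₁ + P₂) - m₂ := by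
    field_simp
  have e₃ : P₁ * (m₁ + m₂) / (P₁ + P₂) - m₁ + (P₂ * (m₁ + m₂) / (P₁ + P₂) - m₂) = 0 := by
    field_simp
    ring
  have k₁ := mul_le_mul_of_nonneg_left h₁ hm₁.le
  have k₂ := mul_le_mul_of_nonneg_left h₂ hm₂.le
  rw [e₁] at k₁
  rw [e₂] at k₂
  nlinarith [k₁, k₂, e₃]

/-- **KEY** (memo §2 (KEY)): on the 4-cycle `a–u–b–v–a` with independent marks at `u` (prob `1−q₁`) and `v` (prob `1−q₂`), the events
`E_a = {a has an open edge and its cluster is unmarked}`, `E_b` (likewise) are positively correlated: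
`P(E_a)·P(E_b) ≤ P(E_a ∩ E_b) = w₀ + C q₁q₂` (`w₀` = P(a~b, unmarked), `C` = P(crossed configuration)).  Written out as the explicit
certificate 'conditional covariances given the marks + Harris for two decreasing functions of the marks', every summand a product of
nonnegative polynomials. -/
theorem key_le {α₁ α₂ β₁ β₂ q₁ q₂ : ℝ}
    (hα₁ : 0 ≤ α₁) (hα₁1 : α₁ ≤ 1) (hα₂ : 0 ≤ α₂) (hα₂1 : α₂ ≤ 1)
    (hβ₁ : 0 ≤ β₁) (hβ₁1 : β₁ ≤ 1) (hβ₂ : 0 ≤ β₂) (hβ₂1 : β₂ ≤ 1)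
    (hq₁ : 0 ≤ q₁) (hq₁1 : q₁ ≤ 1) (hq₂ : 0 ≤ q₂) (hq₂1 : q₂ ≤ 1) :
    (α₁ * α₂ * q₁ * q₂ + α₁ * (1 - α₂) * q₁ * (1 - β₁ * β₂ * (1 - q₂)) + (1 - α₁) * α₂ * q₂ * (1 - β₁ * β₂ * (1 - q₁)))
      * (β₁ * β₂ * q₁ * q₂ + β₁ * (1 - β₂) * q₁ * (1 - α₁ * α₂ * (1 - q₂)) + (1 - β₁) * β₂ * q₂ * (1 - α₁ * α₂ * (1 - q₁)))
      ≤ (q₁ * q₂ * ((1 - (1 - α₁) * (1 - α₂)) * (1 - (1 - β₁) * (1 - β₂)) - ((1 - α₁) * α₂ * (β₁ * (1 - β₂)) + α₁ * (1 - α₂) * ((1 - β₁) * β₂)))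
          + ((1 - q₁) * q₂ * ((1 - α₁) * α₂ * ((1 - β₁) * β₂)) + q₁ * (1 - q₂) * (α₁ * (1 - α₂) * (β₁ * (1 - β₂)))))
        + (α₁ * β₂ * (1 - β₁) * (1 - α₂) + α₂ * β₁ * (1 - α₁) * (1 - β₂)) * q₁ * q₂ := by
  have h1α₁ : 0 ≤ 1 - α₁ := by linarith
  have h1α₂ : 0 ≤ 1 - α₂ := by linarith
  have h1β₁ : 0 ≤ 1 - β₁ := by linarith
  have h1β₂ : 0 ≤ 1 - β₂ := by linarith
  have h1q₁ : 0 ≤ 1 - q₁ := by linarith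
  have h1q₂ : 0 ≤ 1 - q₂ := by linarith
  have hab : 0 ≤ 1 - (1 - β₁ * β₂) * (1 - α₁ * α₂) := by
    have h1 : 0 ≤ 1 - β₁ * β₂ := by nlinarith
    have h2 : 1 - β₁ * β₂ ≤ 1 := by nlinarith
    have h3 : 0 ≤ 1 - α₁ * α₂ := by nlinarith
    have h4 : 1 - α₁ * α₂ ≤ 1 := by nlinarith
    nlinarith [mul_le_mul h2 h4 h3 zero_le_one]
  have hbb : 0 ≤ 1 - β₁ * β₂ := by nlinarith
  have haa : 0 ≤ 1 - α₁ * α₂ := by nlinarith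
  -- the certificate
  have key :
      (q₁ * q₂ * ((1 - (1 - α₁) * (1 - α₂)) * (1 - (1 - β₁) * (1 - β₂)) - ((1 - α₁) * α₂ * (β₁ * (1 - β₂)) + α₁ * (1 - α₂) * ((1 - β₁) * β₂)))
          + ((1 - q₁) * q₂ * ((1 - α₁) * α₂ * ((1 - β₁) * β₂)) + q₁ * (1 - q₂) * (α₁ * (1 - α₂) * (β₁ * (1 - β₂)))))
        + (α₁ * β₂ * (1 - β₁) * (1 - α₂) + α₂ * β₁ * (1 - α₁) * (1 - β₂)) * q₁ * q₂
      - (α₁ * α₂ * q₁ * q₂ + α₁ * (1 - α₂) * q₁ * (1 - β₁ * β₂ * (1 - q₂)) + (1 - α₁) * α₂ * q₂ * (1 - β₁ * β₂ * (1 - q₁)))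
        * (β₁ * β₂ * q₁ * q₂ + β₁ * (1 - β₂) * q₁ * (1 - α₁ * α₂ * (1 - q₂)) + (1 - β₁) * β₂ * q₂ * (1 - α₁ * α₂ * (1 - q₁)))
      = (1 - q₁) * q₂ * ((1 - α₁) * (1 - β₁) * α₂ * β₂ * (1 - (1 - β₁ * β₂) * (1 - α₁ * α₂)))
        + q₁ * (1 - q₂) * ((1 - α₂) * (1 - β₂) * α₁ * β₁ * (1 - (1 - β₁ * β₂) * (1 - α₁ * α₂)))
        + q₁ * ((1 - q₂) * q₂) * ((α₂ + α₁ * (1 - α₂) * β₁ * β₂) * (β₂ + β₁ * (1 - β₂) * α₁ * α₂))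
        + (1 - q₁) * ((1 - q₂) * q₂) * (((1 - α₁) * α₂ * (1 - β₁ * β₂)) * ((1 - β₁) * β₂ * (1 - α₁ * α₂)))
        + (1 - q₁) * q₁ * ((q₂ * (α₁ + (1 - α₁) * α₂ * β₁ * β₂) + (1 - q₂) * (α₁ * (1 - α₂) * (1 - β₁ * β₂)))
            * (q₂ * (β₁ + (1 - β₁) * β₂ * α₁ * α₂) + (1 - q₂) * (β₁ * (1 - β₂) * (1 - α₁ * α₂)))) := by
    ring
  have hpos : 0 ≤ (1 - q₁) * q₂ * ((1 - α₁) * (1 - β₁) * α₂ * β₂ * (1 - (1 - β₁ * β₂) * (1 - α₁ * α₂)))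
        + q₁ * (1 - q₂) * ((1 - α₂) * (1 - β₂) * α₁ * β₁ * (1 - (1 - β₁ * β₂) * (1 - α₁ * α₂)))
        + q₁ * ((1 - q₂) * q₂) * ((α₂ + α₁ * (1 - α₂) * β₁ * β₂) * (β₂ + β₁ * (1 - β₂) * α₁ * α₂))
        + (1 - q₁) * ((1 - q₂) * q₂) * (((1 - α₁) * α₂ * (1 - β₁ * β₂)) * ((1 - β₁) * β₂ * (1 - α₁ * α₂)))
        + (1 - q₁) * q₁ * ((q₂ * (α₁ + (1 - α₁) * α₂ * β₁ * β₂) + (1 - q₂) * (α₁ * (1 - α₂) * (1 - β₁ * β₂)))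
            * (q₂ * (β₁ + (1 - β₁) * β₂ * α₁ * α₂) + (1 - q₂) * (β₁ * (1 - β₂) * (1 - α₁ * α₂)))) := by
    positivity
  linarith [key, hpos]

set_option maxHeartbeats 800000 in
/-- **LEMMA C4-MO** (memo §2): the 4-cycle `C₄ = {a–u, a–v, u–b, v–b}` carrying a Marshall–Olkin correlated mark pair at `(u,v)`
(`ν = q_Xq₁q₂`, `α = q_X(1−q₁)q₂`, `β = q_Xq₁(1−q₂)`, `τ = 1−ν−α−β`) satisfies
`Cov(A,B) − C·(ντ − αβ) ≤ m·log(S/m)`, `m = P(a~b, unmarked)`, `S = P(a~b)`, `C` = pivotality of the slot `uv`.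
Proof: mixture over the common shock; the idiosyncratic component is `GZWheatstone.c4_cov_le`; `key_le`; `log(1/q_X) ≥ 1−q_X`. -/
theorem c4mo {α₁ α₂ β₁ β₂ q₁ q₂ qX ν α β τ : ℝ}
    (hα₁ : 0 < α₁) (hα₁1 : α₁ < 1) (hα₂ : 0 < α₂) (hα₂1 : α₂ < 1)
    (hβ₁ : 0 < β₁) (hβ₁1 : β₁ < 1) (hβ₂ : 0 < β₂) (hβ₂1 : β₂ < 1)
    (hq₁ : 0 < q₁) (hq₁1 : q₁ ≤ 1) (hq₂ : 0 < q₂) (hq₂1 : q₂ ≤ 1) (hqX : 0 < qX) (hqX1 : qX ≤ 1)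
    (hν : ν = qX * q₁ * q₂) (hα : α = qX * (1 - q₁) * q₂) (hβ : β = qX * q₁ * (1 - q₂)) (hτ : τ = 1 - ν - α - β)
    {S C A B Ua Ub Va Vb Su Sv PA PB PAB m : ℝ}
    (hS : S = α₁ * β₁ + α₂ * β₂ - α₁ * α₂ * β₁ * β₂)
    (hC : C = α₁ * β₂ * (1 - β₁) * (1 - α₂) + α₂ * β₁ * (1 - α₁) * (1 - β₂))
    (hA : A = 1 - (1 - α₁) * (1 - α₂)) (hB : B = 1 - (1 - β₁) * (1 - β₂))
    (hUa : Ua = α₁ + (1 - α₁) * α₂ * β₂ * β₁) (hUb : Ub = β₁ + (1 - β₁) * β₂ * α₂ * α₁)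
    (hVa : Va = α₂ + (1 - α₂) * α₁ * β₁ * β₂) (hVb : Vb = β₂ + (1 - β₂) * β₁ * α₁ * α₂)
    (hSu : Su = S - α₂ * β₂ * (1 - α₁) * (1 - β₁)) (hSv : Sv = S - α₁ * β₁ * (1 - α₂) * (1 - β₂))
    (hPA : PA = τ * A + α * Ua + β * Va) (hPB : PB = τ * B + α * Ub + β * Vb)
    (hPAB : PAB = τ * S + α * Su + β * Sv + C * τ) (hm : m = S - (τ * S + α * Su + β * Sv)) :
    PAB - PA * PB - C * (ν * τ - α * β) ≤ m * Real.log (S / m) := by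
  obtain ⟨h1α₁, h1α₂, h1β₁, h1β₂⟩ : 0 < 1 - α₁ ∧ 0 < 1 - α₂ ∧ 0 < 1 - β₁ ∧ 0 < 1 - β₂ :=
    ⟨by linarith, by linarith, by linarith, by linarith⟩
  have h1q₁ : 0 ≤ 1 - q₁ := by linarith
  have h1q₂ : 0 ≤ 1 - q₂ := by linarith
  have h1qX : 0 ≤ 1 - qX := by linarith
  -- the idiosyncratic component: C₄ with independent hubs γ₁ = 1 - q₁ at u, γ₂ = 1 - q₂ at v (THEOREM SP, cell level)
  obtain ⟨w₀, hw₀⟩ : ∃ x : ℝ, x = q₁ * q₂ * S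
      + ((1 - q₁) * q₂ * ((1 - α₁) * α₂ * ((1 - β₁) * β₂)) + q₁ * (1 - q₂) * (α₁ * (1 - α₂) * (β₁ * (1 - β₂)))) := ⟨_, rfl⟩
  obtain ⟨P0A, hP0A⟩ : ∃ x : ℝ, x = (1 - q₁) * q₂ * (α₁ + (1 - α₁) * α₂ * (β₁ * β₂))
      + q₁ * (1 - q₂) * (α₂ + α₁ * (1 - α₂) * (β₁ * β₂)) + (1 - q₁) * (1 - q₂) * (1 - (1 - α₁) * (1 - α₂)) := ⟨_, rfl⟩
  obtain ⟨P0B, hP0B⟩ : ∃ x : ℝ, x = (1 - q₁) * q₂ * (β₁ + (1 - β₁) * β₂ * (α₁ * α₂))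
      + q₁ * (1 - q₂) * (β₂ + β₁ * (1 - β₂) * (α₁ * α₂)) + (1 - q₁) * (1 - q₂) * (1 - (1 - β₁) * (1 - β₂)) := ⟨_, rfl⟩
  obtain ⟨P0AB, hP0AB⟩ : ∃ x : ℝ, x = S - w₀
      + (1 - q₁) * (1 - q₂) * ((1 - α₁) * α₂ * (β₁ * (1 - β₂)) + α₁ * (1 - α₂) * ((1 - β₁) * β₂)) := ⟨_, rfl⟩
  have hs₀ : q₁ * q₂ = (1 - (1 - q₁)) * (1 - (1 - q₂)) := by ring
  have hs₁ : (1 - q₁) * q₂ = (1 - q₁) * (1 - (1 - q₂)) := by ring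
  have hs₂ : q₁ * (1 - q₂) = (1 - (1 - q₁)) * (1 - q₂) := by ring
  have hs₃ : (1 - q₁) * (1 - q₂) = (1 - q₁) * (1 - q₂) := rfl
  have hpa : (1 - (1 - α₁) * (1 - α₂)) = 1 - (1 - α₁) * (1 - α₂) := rfl
  have hpb : (1 - (1 - β₁) * (1 - β₂)) = 1 - (1 - β₁) * (1 - β₂) := rfl
  have hy₁ : (1 - α₁) * α₂ = (1 - α₁) * α₂ := rfl
  have hy₂ : α₁ * (1 - α₂) = α₁ * (1 - α₂) := rfl
  have hz₁ : (1 - β₁) * β₂ = (1 - β₁) * β₂ := rfl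
  have hz₂ : β₁ * (1 - β₂) = β₁ * (1 - β₂) := rfl
  have hX₁ : (1 - α₁) * α₂ * ((1 - β₁) * β₂) = ((1 - α₁) * α₂) * ((1 - β₁) * β₂) := rfl
  have hX₂ : α₁ * (1 - α₂) * (β₁ * (1 - β₂)) = (α₁ * (1 - α₂)) * (β₁ * (1 - β₂)) := rfl
  have hXc : (1 - α₁) * α₂ * (β₁ * (1 - β₂)) + α₁ * (1 - α₂) * ((1 - β₁) * β₂)
      = ((1 - α₁) * α₂) * (β₁ * (1 - β₂)) + (α₁ * (1 - α₂)) * ((1 - β₁) * β₂) := rfl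
  have hθC : S = (1 - (1 - α₁) * (1 - α₂)) * (1 - (1 - β₁) * (1 - β₂))
      - ((1 - α₁) * α₂ * (β₁ * (1 - β₂)) + α₁ * (1 - α₂) * ((1 - β₁) * β₂)) := by rw [hS]; ring
  have h0 := GZWheatstone.c4_cov_le hα₁ hα₁1 hα₂ hα₂1 hβ₁ hβ₁1 hβ₂ hβ₂1
    (γ₁ := 1 - q₁) (γ₂ := 1 - q₂) h1q₁ (by linarith) h1q₂ (by linarith)
    hs₀ hs₁ hs₂ hs₃ hpa hpb hy₁ hy₂ hz₁ hz₂ hX₁ hX₂ hXc hθC hw₀ hP0A hP0B hP0AB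
  -- basic signs
  have hS0 : 0 < S := by
    have e : S = α₁ * β₁ * (1 - α₂ * β₂) + α₂ * β₂ := by rw [hS]; ring
    have h1 : 0 < 1 - α₂ * β₂ := by nlinarith [mul_lt_mul'' hα₂1 hβ₂1 hα₂.le hβ₂.le]
    rw [e]; positivity
  have hC0 : 0 ≤ C := by rw [hC]; positivity
  have hw₀pos : 0 < w₀ := by
    have h1 : 0 < q₁ * q₂ * S := by positivity
    have h2 : 0 ≤ (1 - q₁) * q₂ * ((1 - α₁) * α₂ * ((1 - β₁) * β₂)) + q₁ * (1 - q₂) * (α₁ * (1 - α₂) * (β₁ * (1 - β₂))) := by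
      positivity
    rw [hw₀]; linarith
  -- the mixture identities (exact polynomial identities, memo §2 (MIX))
  have em : m = qX * w₀ := by
    rw [hm, hw₀, hSu, hSv, hS, hτ, hν, hα, hβ]; ring
  obtain ⟨dA, hdA⟩ : ∃ x : ℝ, x = α₁ * α₂ * q₁ * q₂ + α₁ * (1 - α₂) * q₁ * (1 - β₁ * β₂ * (1 - q₂))
      + (1 - α₁) * α₂ * q₂ * (1 - β₁ * β₂ * (1 - q₁)) := ⟨_, rfl⟩
  obtain ⟨dB, hdB⟩ : ∃ x : ℝ, x = β₁ * β₂ * q₁ * q₂ + β₁ * (1 - β₂) * q₁ * (1 - α₁ * α₂ * (1 - q₂))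
      + (1 - β₁) * β₂ * q₂ * (1 - α₁ * α₂ * (1 - q₁)) := ⟨_, rfl⟩
  have ecov : PAB - PA * PB = qX * (P0AB - P0A * P0B) + (1 - qX) * qX * (dA * dB) := by
    rw [hPAB, hPA, hPB, hP0AB, hP0A, hP0B, hw₀, hdA, hdB, hSu, hSv, hS, hC, hA, hB, hUa, hUb, hVa, hVb, hτ, hν, hα, hβ]
    ring
  have emu : ν * τ - α * β = (1 - qX) * qX * (q₁ * q₂) := by
    rw [hτ, hν, hα, hβ]; ring
  -- KEY
  have hkey : dA * dB ≤ w₀ + C * q₁ * q₂ := by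
    rw [hdA, hdB, hw₀, hC, hθC]
    exact key_le hα₁.le hα₁1.le hα₂.le hα₂1.le hβ₁.le hβ₁1.le hβ₂.le hβ₂1.le hq₁.le hq₁1 hq₂.le hq₂1
  -- logarithms: m log(S/m) = qX w₀ (log(S/w₀) − log qX) and −log qX ≥ 1 − qX
  have hlog : Real.log (S / (qX * w₀)) = Real.log (S / w₀) - Real.log qX := by
    rw [Real.log_div hS0.ne' (mul_pos hqX hw₀pos).ne', Real.log_div hS0.ne' hw₀pos.ne', Real.log_mul hqX.ne' hw₀pos.ne']
    ring
  have hlq : Real.log qX ≤ qX - 1 := Real.log_le_sub_one_of_pos hqX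
  -- assemble
  rw [ecov, emu, em, hlog]
  have hqq : 0 ≤ (1 - qX) * qX := mul_nonneg h1qX hqX.le
  have t1 : (1 - qX) * qX * (dA * dB) - C * ((1 - qX) * qX * (q₁ * q₂)) ≤ (1 - qX) * qX * w₀ := by
    have k := mul_le_mul_of_nonneg_left hkey hqq
    have e : (1 - qX) * qX * (w₀ + C * q₁ * q₂) = (1 - qX) * qX * w₀ + C * ((1 - qX) * qX * (q₁ * q₂)) := by ring
    linarith [k, e]
  have t2 : qX * (P0AB - P0A * P0B) ≤ qX * (w₀ * Real.log (S / w₀)) := mul_le_mul_of_nonneg_left h0 hqX.le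
  have t3 : (1 - qX) * qX * w₀ ≤ qX * w₀ * (-Real.log qX) := by
    have k := mul_le_mul_of_nonneg_left (show 1 - qX ≤ -Real.log qX by linarith) (mul_nonneg hqX.le hw₀pos.le)
    have e : qX * w₀ * (1 - qX) = (1 - qX) * qX * w₀ := by ring
    linarith [k, e]
  linarith [t1, t2, t3]

set_option maxHeartbeats 800000 in
/-- **THEOREM W⁺ (cell level, bridge slot)** — the logarithmic covariance bound
`P(a~c ∧ b~c) − P(a~c)P(b~c) ≤ P(ab|c)·log(P(a ~ b off c)/P(ab|c))` for the Wheatstone bridge whose bridge slot `u–v` carries an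
arbitrary two-terminal gadget `B` with connection data `θ_B ≥ w_B > 0` and mark-pattern law `(τ, α, β, ν)` (both / only-u / only-v / no
side marked; `τ ≥ 0` follows from `hH` and `ν > 0`) satisfying L-log (`hL`) and Harris (`hH`); cells of the composite as in the module
docstring.  Contains THEOREM W.
[this work — memo THEOREM-WPLUS.md] -/
theorem wplus_bridge_cov_le {α₁ α₂ β₁ β₂ τ α β ν θB wB : ℝ}
    (hα₁ : 0 < α₁) (hα₁1 : α₁ < 1) (hα₂ : 0 < α₂) (hα₂1 : α₂ < 1)
    (hβ₁ : 0 < β₁) (hβ₁1 : β₁ < 1) (hβ₂ : 0 < β₂) (hβ₂1 : β₂ < 1)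
    (hα : 0 ≤ α) (hβ : 0 ≤ β) (hν : 0 < ν) (hsum : τ + α + β + ν = 1)
    (hH : α * β ≤ ν * τ) (hwB : 0 < wB) (hθB : wB ≤ θB)
    (hL : ν * τ - α * β ≤ wB * Real.log (θB / wB))
    {S C A B Ua Ub Va Vb Su Sv PA PB PAB m θ w : ℝ}
    (hS : S = α₁ * β₁ + α₂ * β₂ - α₁ * α₂ * β₁ * β₂)
    (hC : C = α₁ * β₂ * (1 - β₁) * (1 - α₂) + α₂ * β₁ * (1 - α₁) * (1 - β₂))
    (hA : A = 1 - (1 - α₁) * (1 - α₂)) (hB : B = 1 - (1 - β₁) * (1 - β₂))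
    (hUa : Ua = α₁ + (1 - α₁) * α₂ * β₂ * β₁) (hUb : Ub = β₁ + (1 - β₁) * β₂ * α₂ * α₁)
    (hVa : Va = α₂ + (1 - α₂) * α₁ * β₁ * β₂) (hVb : Vb = β₂ + (1 - β₂) * β₁ * α₁ * α₂)
    (hSu : Su = S - α₂ * β₂ * (1 - α₁) * (1 - β₁)) (hSv : Sv = S - α₁ * β₁ * (1 - α₂) * (1 - β₂))
    (hPA : PA = τ * A + α * Ua + β * Va) (hPB : PB = τ * B + α * Ub + β * Vb)
    (hPAB : PAB = τ * S + α * Su + β * Sv + C * τ) (hm : m = S - (τ * S + α * Su + β * Sv))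
    (hθ : θ = S + C * θB) (hw : w = m + C * wB) :
    PAB - PA * PB ≤ w * Real.log (θ / w) := by
  obtain ⟨h1α₁, h1α₂, h1β₁, h1β₂⟩ : 0 < 1 - α₁ ∧ 0 < 1 - α₂ ∧ 0 < 1 - β₁ ∧ 0 < 1 - β₂ :=
    ⟨by linarith, by linarith, by linarith, by linarith⟩
  have hS0 : 0 < S := by
    have e : S = α₁ * β₁ * (1 - α₂ * β₂) + α₂ * β₂ := by rw [hS]; ring
    have h1 : 0 < 1 - α₂ * β₂ := by nlinarith [mul_lt_mul'' hα₂1 hβ₂1 hα₂.le hβ₂.le]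
    rw [e]; positivity
  have hC0 : 0 < C := by rw [hC]; positivity
  have hθB0 : 0 < θB := lt_of_lt_of_le hwB hθB
  -- Marshall–Olkin coordinates of the mark pattern
  have hνα : 0 < ν + α := by linarith
  have hνβ : 0 < ν + β := by linarith
  obtain ⟨q₁, hq₁⟩ : ∃ x : ℝ, x = ν / (ν + α) := ⟨_, rfl⟩
  obtain ⟨q₂, hq₂⟩ : ∃ x : ℝ, x = ν / (ν + β) := ⟨_, rfl⟩
  obtain ⟨qX, hqX⟩ : ∃ x : ℝ, x = (ν + α) * (ν + β) / ν := ⟨_, rfl⟩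
  have hq₁0 : 0 < q₁ := by rw [hq₁]; positivity
  have hq₂0 : 0 < q₂ := by rw [hq₂]; positivity
  have hqX0 : 0 < qX := by rw [hqX]; positivity
  have hq₁1 : q₁ ≤ 1 := by rw [hq₁, div_le_one hνα]; linarith
  have hq₂1 : q₂ ≤ 1 := by rw [hq₂, div_le_one hνβ]; linarith
  have hqX1 : qX ≤ 1 := by
    rw [hqX, div_le_one hν]
    have h1 : (ν + α) * (ν + β) = ν * (ν + α + β) + α * β := by ring
    have h3 : ν * (ν + α + β) + ν * τ = ν * (τ + α + β + ν) := by ring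
    rw [hsum, mul_one] at h3
    rw [h1]; linarith [hH, h3]
  have eν : ν = qX * q₁ * q₂ := by
    rw [hqX, hq₁, hq₂]; field_simp
  have eα : α = qX * (1 - q₁) * q₂ := by
    rw [hqX, hq₁, hq₂]; field_simp; ring
  have eβ : β = qX * q₁ * (1 - q₂) := by
    rw [hqX, hq₁, hq₂]; field_simp; ring
  have eτ : τ = 1 - ν - α - β := by linarith
  -- LEMMA C4-MO
  have hc4 := c4mo hα₁ hα₁1 hα₂ hα₂1 hβ₁ hβ₁1 hβ₂ hβ₂1 hq₁0 hq₁1 hq₂0 hq₂1 hqX0 hqX1 eν eα eβ eτ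
    hS hC hA hB hUa hUb hVa hVb hSu hSv hPA hPB hPAB hm
  -- m > 0
  have hm0 : 0 < m := by
    have e : m = ν * S + α * (α₂ * β₂ * (1 - α₁) * (1 - β₁)) + β * (α₁ * β₁ * (1 - α₂) * (1 - β₂)) := by
      rw [hm, hSu, hSv, eτ]; ring
    rw [e]
    have h1 : 0 < ν * S := mul_pos hν hS0
    have h2 : 0 ≤ α * (α₂ * β₂ * (1 - α₁) * (1 - β₁)) := by positivity
    have h3 : 0 ≤ β * (α₁ * β₁ * (1 - α₂) * (1 - β₂)) := by positivity
    linarith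
  -- two-class log-sum + L-log of the gadget in the pivotal class
  have hls := logsum2 (m₁ := m) (m₂ := C * wB) (P₁ := S) (P₂ := C * θB) hm0 (by positivity) hS0 (by positivity)
  have e2 : C * θB / (C * wB) = θB / wB := by
    rw [mul_div_mul_left _ _ hC0.ne']
  rw [e2] at hls
  have hcred : C * (ν * τ - α * β) ≤ C * wB * Real.log (θB / wB) := by
    have := mul_le_mul_of_nonneg_left hL hC0.le
    linarith
  rw [hθ, hw]
  linarith [hc4, hls, hcred]

end GZWheatstonePlus

end Summit.CriticalPhenomena.PercolationContinuityZ3.Theorems
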